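import Literature.NumberTheory.Automorphic.GodementJacquetPartialL
import Literature.NumberTheory.Automorphic.SatakeParameterUnitBound
import Literature.NumberTheory.Automorphic.RankinSelbergContinuationGlue
import HarnessLib

/-!
# Holomorphy of `L^S(s, Π)` on `re s > 1`: reductions of
`JacquetShalika1981_differentiableOn_partialStandardL`
(companion to `Literature.NumberTheory.Automorphic.GodementJacquetPartialL`; theorems only)

The named fact `JacquetShalika1981_differentiableOn_partialStandardL` of `GodementJacquetPartialL`
(Jacquet–Shalika, *On Euler products and the classification of automorphic representations I*,
Amer. J. Math. **103** (1981), Thm. (5.3) with Remark (5.4): for a cuspidal automorphic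
representation `Π` of `GL_n(𝔸_K)`, a finite set `S` of finite places and an honest Satake family
`α` of `Π` off `S`, the partial standard Euler product `L^S(s, Π) = partialStandardL ↑S α` is
holomorphic on the open half-plane `re s > 1`) is derived there from the single input
(5.3.3)–(5.3.4) of the printed proof (`summable_normSq_trace_satakePow` of
`AutomorphicLFunctionProofs`, for *arbitrary* exceptional sets). This file records, with proofs,
exactly what the fact rests on over the tree's honest definitions, and the cases in which it is
already a theorem:

* `differentiableOn_partialStandardL_of_summable_normSq_trace` (**the analytic core, for one
  Satake family, no automorphic input**): if `card (α v) ≤ n` off `S` and the series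
  `∑_{v ∉ S} ∑_{k ≥ 1} |tr A_v^k|² / (k q_v^{kσ})` converges for every `σ > 1`, then
  `L^S(s, α)` is holomorphic and non-zero on `re s > 1` (the convergence bounds the parameters by
  `q_v^{1/2}`, `norm_le_sqrt_of_summable_normSq_trace`; then the Euler product converges normally
  on every half-plane `re s > σ₁ > 1`, `differentiableOn_partialStandardL_of_norm_sub_one_le`);
* `exists_finset_differentiableOn_partialStandardL_of_lemma52` (**Lemma (5.2) alone suffices
  off the exceptional sets of the lemma**): from `JacquetShalika1981_continuation_partialPairL_conj`
  (loc. cit. Lemma (5.2): continuation of `L_S(s, π × π̄)` to `re s > 1` for finite `S ⊇ S₀`)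
  every `L^S(s, Π)`, `S ⊇ S₀`, is holomorphic and non-zero on `re s > 1` — Landau's lemma with
  the proved trivial bound (`summable_normSq_trace_finset_of_lemma52'`), no Cor. (2.5)/(5.1.3);
* `partialStandardL_eq_prod_mul_partialStandardL` (splitting off finitely many places of a
  multipliable partial Euler product) and
  `JacquetShalika1981_differentiableOn_partialStandardL_of_lemma52_of_norm_le` (**the exact
  residual local input**): the fact follows from Lemma (5.2) together with the bound
  `‖a‖ ≤ q_v` on the Hecke–Satake parameters at the unramified places — i.e. no local factor
  `(1 - a q_v^{-s})⁻¹` at one of the finitely many unramified places of `S₀ ∖ S` has a pole on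
  `re s > 1` — a bound weaker than (5.1.3) `‖a‖ ≤ q_v^{1/2}` (`norm_satakeParameter_le_sqrt`,
  loc. cit. Cor. (2.5)), whence `JacquetShalika1981_differentiableOn_partialStandardL_of_lemma52`
  (**the fact from the two numbered inputs Lemma (5.2) and (5.1.3)**, the current frontier of
  `JacquetShalika1981_differentiableOn_partialStandardL_holds`) and
  `JacquetShalika1981_differentiableOn_partialStandardL_of_local_quotients` (from (5.1.3) and
  the Rankin–Selberg quotient representation of `L_S(s, π × π̄)` of
  `RankinSelbergContinuationGlue`);
* `JacquetShalika1981_differentiableOn_partialStandardL_of_finset_summable`: the fact from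
  (5.3.3)–(5.3.4) in the printed generality (finite exceptional sets) — directly, without the
  finiteness of ramification used by `SummableNormSqTraceSatakePow`;
* `JacquetShalika1981_differentiableOn_partialStandardL_of_norm_le_one`, `_of_ramanujan`,
  `_of_le_one`: the fact under the unit bound on the Satake parameters, under clause (i) of the
  Ramanujan conjecture, and **unconditionally in rank `n ≤ 1`** (holomorphy on `re s > 1` of the
  partial Hecke `L`-functions `∏_{v ∉ S} (1 - χ_v(ϖ_v) q_v^{-s})⁻¹` of the unitary characters of
  `𝔸_K^× / K^× ℝ_{>0}` over the tree's `L²`/Hecke-operator definitions, via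
  `SatakeParameterUnitBound`).

What remains for an unconditional `JacquetShalika1981_differentiableOn_partialStandardL_holds`
is therefore Lemma (5.2) (the global Rankin–Selberg theory for `GL_n × GL_n`: Whittaker
coefficients and the Fourier expansion of cusp forms, the mirabolic Eisenstein series and its
continuation, the Euler factorisation with the unramified computation, the local theory at the
places of `S`; being vendored in the tree bottom-up, cf. `GlobalWhittakerCoefficient`,
`ShintaniWhittakerFormula`, `RankinSelbergContinuationGlue`) and the local bound (5.1.3) at the
finitely many unramified places inside the exceptional set of the lemma (Cor. (2.5): unitary
generic unramified representations of `GL_n(K_v)` have Satake parameters of absolute value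
`< q_v^{1/2}`).

## References

* H. Jacquet, J. A. Shalika, *On Euler products and the classification of automorphic
  representations I*, Amer. J. Math. 103 (1981), 499–558: Thm. (5.3) p. 555 and its proof
  pp. 555–557 ((5.3.3)–(5.3.4) p. 556), Remark (5.4) p. 557, Lemma (5.2) p. 554, (5.1.3) p. 554,
  Cor. (2.5) p. 515 [JacquetShalikaAJM1981].
* J. W. Cogdell, *Analytic theory of `L`-functions for `GL_n`*, in: J. Bernstein, S. Gelbart
  (eds.), *An Introduction to the Langlands Program*, Birkhäuser (2003), §4.1–§4.2 (the
  Rankin–Selberg paradigm for the continuation).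
-/

noncomputable section

open Set Filter Topology NumberField IsDedekindDomain MeasureTheory Complex

namespace Literature.NumberTheory.Automorphic

/-! ### The analytic core: holomorphy from (5.3.3), for one Satake family -/

section Family

variable {K : Type} [Field K] [NumberField K]

/-- **Holomorphy and non-vanishing of `L^S(s, α)` on `re s > 1` from (5.3.3)–(5.3.4), for one
Satake family.** Let `α` be a Satake family with `card (α v) ≤ n` for `v ∉ S`, and suppose that
`∑_{v ∉ S} ∑_{k ≥ 1} |tr A_v^k|² / (k q_v^{kσ}) < ∞` for every `σ > 1` (statement (5.3.3)–(5.3.4)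
of the proof of Jacquet–Shalika's Thm. (5.3), for this family). Then the partial Euler product
`L^S(s, α) = ∏_{v ∉ S} (∏_{a ∈ α v} (1 - a q_v^{-s}))⁻¹` (`partialStandardL S α`) is holomorphic
and non-zero on `re s > 1`: the convergence bounds every `a ∈ α v` by `q_v^{1/2}`
(`norm_le_sqrt_of_summable_normSq_trace`), so that on `re s > σ₁ > 1`
`‖∏_{a ∈ α v}(1 - a q_v^{-s}) - 1‖ ≤ |tr A_v|² q_v^{-σ₁} + q_v^{-σ₁} + 4^n q_v^{1 - 2σ₁}`
(`norm_eval_eulerPolynomial_sub_one_le_of_sqrt`), summable over `v` by the terms `k = 1` of the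
series and `∑_v q_v^{-t} < ∞` (`t > 1`), and no factor vanishes
(`eval_eulerPolynomial_ne_zero_of_sqrt`); conclude by normal convergence on every such half-plane
(`differentiableOn_partialStandardL_of_norm_sub_one_le`). This is the `Π`-free content of
`differentiableOn_partialStandardL_of_summable` of `GodementJacquetPartialL` (loc. cit. p. 555:
"the infinite product … is absolutely convergent in the half-plane `Re(s) > 1`. In particular
the function `L_S(s, π × π')` does not vanish for `Re(s) > 1`", case `π' = 1` of Remark (5.4)).
[cite: JacquetShalikaAJM1981, Thm. (5.3), proof, (5.3.3)–(5.3.4); Remark (5.4)] -/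
theorem differentiableOn_partialStandardL_of_summable_normSq_trace
    {S : Set (HeightOneSpectrum (𝓞 K))} {α : SatakeFamily K} {n : ℕ}
    (hcard : ∀ v ∉ S, Multiset.card (α v) ≤ n)
    (hs : ∀ σ : ℝ, 1 < σ → Summable fun kv : ℕ × {v : HeightOneSpectrum (𝓞 K) // v ∉ S} =>
      ‖((α kv.2.1).map (· ^ (kv.1 + 1))).sum‖ ^ 2 /
        ((kv.1 + 1 : ℝ) * (kv.2.1.residueCard : ℝ) ^ ((kv.1 + 1 : ℝ) * σ))) :
    DifferentiableOn ℂ (partialStandardL S α) {s : ℂ | 1 < s.re} ∧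
      ∀ s : ℂ, 1 < s.re → partialStandardL S α s ≠ 0 := by
  -- (5.1.3) off `S` is a consequence of (5.3.3)
  have hsqrt : ∀ v ∉ S, ∀ a ∈ α v, ‖a‖ ≤ Real.sqrt v.residueCard :=
    fun v hv a ha => norm_le_sqrt_of_summable_normSq_trace hs hv ha
  -- holomorphy and non-vanishing on every half-plane `re s > σ₁`, `σ₁ > 1`
  have key : ∀ σ₁ : ℝ, 1 < σ₁ →
      DifferentiableOn ℂ (partialStandardL S α) {s : ℂ | σ₁ < s.re} ∧
        ∀ s : ℂ, σ₁ < s.re → partialStandardL S α s ≠ 0 := by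
    intro σ₁ hσ₁
    -- the Jacquet–Shalika majorant at the real point `σ₁`
    let b : {v : HeightOneSpectrum (𝓞 K) // v ∉ S} → ℝ := fun v =>
      ‖(α v.1).sum‖ ^ 2 * (v.1.residueCard : ℝ) ^ (-σ₁) + (v.1.residueCard : ℝ) ^ (-σ₁) +
        4 ^ n * (v.1.residueCard : ℝ) ^ (1 - 2 * σ₁)
    have hb : Summable b := by
      refine ((?_ : Summable _).add ?_).add ?_
      · refine ((hs σ₁ hσ₁).prod_factor 0).congr fun v => ?_
        have hq0 : (0 : ℝ) ≤ v.1.residueCard := Nat.cast_nonneg _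
        simp [Real.rpow_neg hq0, div_eq_mul_inv]
      · exact (summable_residueCard_rpow_neg hσ₁).subtype _
      · refine (((summable_residueCard_rpow_neg (K := K) (σ := 2 * σ₁ - 1) (by linarith)).subtype
          _).mul_left (4 ^ n)).congr fun v => ?_
        simp [neg_sub]
    refine differentiableOn_partialStandardL_of_norm_sub_one_le hb (fun v s hs' => ?_)
      (fun v s hs' => ?_)
    · have hs'' : σ₁ < s.re := hs'
      have hq1 : (1 : ℝ) ≤ v.1.residueCard := by exact_mod_cast v.1.one_lt_residueCard.le
      have hest := norm_eval_eulerPolynomial_sub_one_le_of_sqrt v.1.one_lt_residueCard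
        (hsqrt v.1 v.2) (s := s) (by linarith)
      refine hest.trans ?_
      have h4 : (4 : ℝ) ^ Multiset.card (α v.1) ≤ 4 ^ n :=
        pow_le_pow_right₀ (by norm_num) (hcard v.1 v.2)
      have hm₁ : (v.1.residueCard : ℝ) ^ (-s.re) ≤ (v.1.residueCard : ℝ) ^ (-σ₁) :=
        Real.rpow_le_rpow_of_exponent_le hq1 (by linarith)
      have hm₂ : (v.1.residueCard : ℝ) ^ (1 - 2 * s.re) ≤ (v.1.residueCard : ℝ) ^ (1 - 2 * σ₁) :=
        Real.rpow_le_rpow_of_exponent_le hq1 (by linarith)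
      show _ ≤ ‖(α v.1).sum‖ ^ 2 * (v.1.residueCard : ℝ) ^ (-σ₁) + (v.1.residueCard : ℝ) ^ (-σ₁) +
        4 ^ n * (v.1.residueCard : ℝ) ^ (1 - 2 * σ₁)
      gcongr
    · have hs'' : σ₁ < s.re := hs'
      exact eval_eulerPolynomial_ne_zero_of_sqrt v.1.one_lt_residueCard (hsqrt v.1 v.2)
        (by linarith)
  refine ⟨differentiableOn_halfPlane_of_forall_lt fun σ₁ hσ₁ => (key σ₁ hσ₁).1, fun s hs' => ?_⟩
  have h₁ : (1 : ℝ) < (1 + s.re) / 2 := by linarith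
  have h₂ : (1 + s.re) / 2 < s.re := by linarith
  exact (key _ h₁).2 s h₂

/-- **Splitting off finitely many places of a multipliable partial Euler product.** For a set
`S` of finite places, a finite set `T` of places disjoint from `S`, and `s` at which the Euler
product of `α` off `S ∪ T` is multipliable,
`L^S(s, α) = (∏_{v ∈ T} (∏_{a ∈ α v}(1 - a q_v^{-s}))⁻¹) · L^{S ∪ T}(s, α)`
(a `tprod` over a type splits as the finite product over the support of the factors at `T`
times the `tprod` of the remaining factors, Mathlib `Multipliable.tprod_mul`). [folklore] -/
theorem partialStandardL_eq_prod_mul_partialStandardL {S : Set (HeightOneSpectrum (𝓞 K))}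
    {T : Finset (HeightOneSpectrum (𝓞 K))} (hT : ∀ v ∈ T, v ∉ S) (α : SatakeFamily K) {s : ℂ}
    (hmul : Multipliable fun v : {v : HeightOneSpectrum (𝓞 K) // v ∉ S ∪ (↑T : Set _)} =>
      ((eulerPolynomial (α v.1)).eval ((v.1.residueCard : ℂ) ^ (-s)))⁻¹) :
    partialStandardL S α s =
      (∏ v ∈ T, ((eulerPolynomial (α v)).eval ((v.residueCard : ℂ) ^ (-s)))⁻¹) *
        partialStandardL (S ∪ ↑T) α s := by
  classical
  -- the local factors, extended by `1`
  set f : HeightOneSpectrum (𝓞 K) → ℂ := fun v =>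
    ((eulerPolynomial (α v)).eval ((v.residueCard : ℂ) ^ (-s)))⁻¹ with hf
  set F : HeightOneSpectrum (𝓞 K) → ℂ := fun v => if v ∈ S then 1 else f v with hF
  set G : HeightOneSpectrum (𝓞 K) → ℂ := fun v => if v ∈ S ∪ (↑T : Set _) then 1 else f v with hG
  set H : HeightOneSpectrum (𝓞 K) → ℂ := fun v => if v ∈ T then f v else 1 with hH
  -- the three `tprod`s over the full type
  have hLS : partialStandardL S α s = ∏' v, F v := by
    have hsupp : Function.mulSupport F ⊆ {v | v ∉ S} := by
      intro v hv hvS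
      exact hv (by simp [hF, show v ∈ S from hvS])
    rw [partialStandardL, ← tprod_subtype_eq_of_mulSupport_subset hsupp]
    exact tprod_congr fun v => by simp [hF, hf, show v.1 ∉ S from v.2]
  have hLST : partialStandardL (S ∪ ↑T) α s = ∏' v, G v := by
    have hsupp : Function.mulSupport G ⊆ {v | v ∉ S ∪ (↑T : Set _)} := by
      intro v hv hvS
      exact hv (by simp only [hG, if_pos hvS])
    rw [partialStandardL, ← tprod_subtype_eq_of_mulSupport_subset hsupp]
    exact tprod_congr fun v => by simp only [hG, hf, if_neg v.2]
  have hHT : ∏' v, H v = ∏ v ∈ T, f v := by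
    rw [tprod_eq_prod (s := T) (fun v hv => by simp [hH, hv])]
    exact Finset.prod_congr rfl fun v hv => by simp [hH, hv]
  -- `F = H * G` pointwise
  have hFGH : ∀ v, F v = H v * G v := by
    intro v
    by_cases hvT : v ∈ T
    · have hvS : v ∉ S := hT v hvT
      have hvST : v ∈ S ∪ (↑T : Set _) := Or.inr (Finset.mem_coe.mpr hvT)
      simp only [hF, hG, hH, if_neg hvS, if_pos hvT, if_pos hvST, mul_one]
    · by_cases hvS : v ∈ S
      · have hvST : v ∈ S ∪ (↑T : Set _) := Or.inl hvS
        simp only [hF, hG, hH, if_pos hvS, if_neg hvT, if_pos hvST, mul_one]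
      · have hvST : v ∉ S ∪ (↑T : Set _) := by
          rintro (h | h)
          · exact hvS h
          · exact hvT (Finset.mem_coe.mp h)
        simp only [hF, hG, hH, if_neg hvS, if_neg hvT, if_neg hvST, one_mul]
  -- multipliability of `G` (the hypothesis, transported) and of `H` (finite support)
  have hGm : Multipliable G := by
    have h1 : Multipliable ((S ∪ (↑T : Set _))ᶜ.mulIndicator f) :=
      multipliable_subtype_iff_mulIndicator.mp hmul
    refine h1.congr fun v => ?_
    by_cases hv : v ∈ S ∪ (↑T : Set _)
    · rw [Set.mulIndicator_of_notMem (by rw [Set.mem_compl_iff, not_not]; exact hv)]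
      simp only [hG, if_pos hv]
    · rw [Set.mulIndicator_of_mem (Set.mem_compl hv)]
      simp only [hG, if_neg hv]
  have hHm : Multipliable H := multipliable_of_ne_finset_one (s := T) fun v hv => by simp [hH, hv]
  rw [hLS, hLST, ← hHT, ← hHm.tprod_mul hGm]
  exact tprod_congr hFGH

/-- A local Euler factor `(∏_{a ∈ α} (1 - a q^{-s}))⁻¹` with `‖a‖ ≤ q` for all `a ∈ α` is
holomorphic on `re s > 1`: there `‖a q^{-s}‖ ≤ q^{1 - re s} < 1`, so the polynomial does not
vanish (`eval_eulerPolynomial_ne_zero_of_norm_mul_lt_one`). [folklore] -/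
theorem differentiableOn_inv_eval_eulerPolynomial_of_norm_le {α : Multiset ℂ} {q : ℕ}
    (hq : 1 < q) (hα : ∀ a ∈ α, ‖a‖ ≤ q) :
    DifferentiableOn ℂ (fun s : ℂ => ((eulerPolynomial α).eval ((q : ℂ) ^ (-s)))⁻¹)
      {s : ℂ | 1 < s.re} := by
  have hq0 : (0 : ℝ) < q := by exact_mod_cast zero_lt_one.trans hq
  refine ((differentiable_eval_eulerPolynomial_cpow_neg α (zero_lt_one.trans hq).ne').differentiableOn).inv
    fun s hs => ?_
  have hs' : 1 < s.re := hs
  refine eval_eulerPolynomial_ne_zero_of_norm_mul_lt_one fun a ha => ?_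
  rw [norm_mul, norm_natCast_cpow_of_pos (zero_lt_one.trans hq), neg_re]
  calc ‖a‖ * (q : ℝ) ^ (-s.re) ≤ (q : ℝ) * (q : ℝ) ^ (-s.re) := by
        gcongr
        exact hα a ha
    _ = (q : ℝ) ^ (1 - s.re) := by
        rw [show (1 - s.re) = 1 + -s.re by ring, Real.rpow_add hq0, Real.rpow_one]
    _ < 1 := Real.rpow_lt_one_of_one_lt_of_neg (by exact_mod_cast hq) (by linarith)

end Family

/-! ### The named fact from Lemma (5.2), and from (5.3.3) for finite exceptional sets -/

section Cuspidal

variable {n : ℕ} {K : Type} [Field K] [NumberField K]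
  {μ : Measure (AdelicGroupData.gl n K).automorphicQuotient}
  [(AdelicGroupData.gl n K).IsAutomorphicMeasure μ]

/-- **Lemma (5.2) alone gives the holomorphy of `L^S(s, Π)` on `re s > 1` off the exceptional
sets of the lemma.** If `L_S(s, π × π̄)` continues to `re s > 1` for all finite `S ⊇ S₀`
(`JacquetShalika1981_continuation_partialPairL_conj`, Jacquet–Shalika (1981), Lemma (5.2)), then
for every finite `S ⊇ S₀` and every Satake family `α` of the cuspidal `Π` off `S`, `L^S(s, Π)` is
holomorphic and non-zero on `re s > 1`: (5.3.3)–(5.3.4) hold off `S` by Landau's lemma, the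
half-plane of absolute convergence being supplied by the proved trivial bound on the Hecke–Satake
parameters (`summable_normSq_trace_finset_of_lemma52'`), and
`differentiableOn_partialStandardL_of_summable_normSq_trace` applies. No local bound (5.1.3) is
used. [cite: JacquetShalikaAJM1981, Thm. (5.3), Lemma (5.2), Remark (5.4)] -/
theorem exists_finset_differentiableOn_partialStandardL_of_lemma52
    (h₅₂ : JacquetShalika1981_continuation_partialPairL_conj (μ := μ))
    (P : CuspidalAutomorphicRepGL n K μ) :
    ∃ S₀ : Finset (HeightOneSpectrum (𝓞 K)), ∀ ⦃S : Finset (HeightOneSpectrum (𝓞 K))⦄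
      ⦃α : SatakeFamily K⦄, S₀ ⊆ S → IsSatakeFamilyOf P ↑S α →
        DifferentiableOn ℂ (partialStandardL ↑S α) {s : ℂ | 1 < s.re} ∧
          ∀ s : ℂ, 1 < s.re → partialStandardL ↑S α s ≠ 0 := by
  obtain ⟨S₀, hS₀⟩ := summable_normSq_trace_finset_of_lemma52' h₅₂ P
  exact ⟨S₀, fun S α hS hα => differentiableOn_partialStandardL_of_summable_normSq_trace
    (fun _ hv => (hα.card_eq hv).le) fun σ hσ => hS₀ hS hα hσ⟩

/-- **The named fact from Lemma (5.2) and the bound `‖a‖ ≤ q_v` at the unramified places.**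
Suppose `L_S(s, π × π̄)` continues to `re s > 1` for finite `S ⊇ S₀`
(`JacquetShalika1981_continuation_partialPairL_conj`, Lemma (5.2)) and every Hecke–Satake
parameter `a` of a cuspidal `Π` at an unramified place `v` satisfies `‖a‖ ≤ q_v` (weaker than
(5.1.3) `‖a‖ ≤ q_v^{1/2}`, Cor. (2.5) of the source; it says that the local factor
`(∏_{a}(1 - a q_v^{-s}))⁻¹` has no pole on `re s > 1`). Then
`JacquetShalika1981_differentiableOn_partialStandardL` holds: given a finite `S` and `α` off `S`,
the product off `S ∪ S₀` is holomorphic on `re s > 1` by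
`exists_finset_differentiableOn_partialStandardL_of_lemma52` (and multipliable there,
`multipliable_inv_eulerFactor`), and `L^S = (∏_{v ∈ S₀ ∖ S} L_v) · L^{S ∪ S₀}`
(`partialStandardL_eq_prod_mul_partialStandardL`) with the finitely many factors `L_v`,
`v ∈ S₀ ∖ S` unramified, holomorphic on `re s > 1`
(`differentiableOn_inv_eval_eulerPolynomial_of_norm_le`). This isolates the only local input the
fact needs beyond Lemma (5.2). [cite: JacquetShalikaAJM1981, Thm. (5.3), Lemma (5.2), Remark (5.4)] -/
theorem JacquetShalika1981_differentiableOn_partialStandardL_of_lemma52_of_norm_le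
    (hq : ∀ (P : CuspidalAutomorphicRepGL n K μ) ⦃S : Set (HeightOneSpectrum (𝓞 K))⦄
      ⦃α : SatakeFamily K⦄, IsSatakeFamilyOf P S α →
        ∀ v ∉ S, ∀ a ∈ α v, ‖a‖ ≤ (v.residueCard : ℝ))
    (h₅₂ : JacquetShalika1981_continuation_partialPairL_conj (μ := μ)) :
    JacquetShalika1981_differentiableOn_partialStandardL (μ := μ) := by
  classical
  intro P S α hα
  obtain ⟨S₀, hS₀⟩ := summable_normSq_trace_finset_of_lemma52' h₅₂ P
  -- the places to split off, and the enlarged exceptional set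
  set T : Finset (HeightOneSpectrum (𝓞 K)) := S₀ \ S with hT
  have hTS : ∀ v ∈ T, v ∉ (↑S : Set (HeightOneSpectrum (𝓞 K))) := fun v hv =>
    fun h => (Finset.mem_sdiff.mp hv).2 (Finset.mem_coe.mp h)
  have hST : (↑S : Set (HeightOneSpectrum (𝓞 K))) ∪ ↑T = ↑(S ∪ S₀) := by
    ext v
    simp only [Set.mem_union, Finset.mem_coe, hT, Finset.mem_sdiff, Finset.mem_union]
    tauto
  have hsub : S₀ ⊆ S ∪ S₀ := Finset.subset_union_right
  have hα' : IsSatakeFamilyOf P ↑(S ∪ S₀) α :=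
    hα.mono (by rw [Finset.coe_union]; exact Set.subset_union_left)
  -- (5.3.3) off `S ∪ S₀`, hence (5.1.3) there, multipliability and holomorphy
  have hsum : ∀ σ : ℝ, 1 < σ →
      Summable fun kv : ℕ × {v : HeightOneSpectrum (𝓞 K) // v ∉ (↑(S ∪ S₀) : Set _)} =>
        ‖((α kv.2.1).map (· ^ (kv.1 + 1))).sum‖ ^ 2 /
          ((kv.1 + 1 : ℝ) * (kv.2.1.residueCard : ℝ) ^ ((kv.1 + 1 : ℝ) * σ)) :=
    fun σ hσ => hS₀ hsub hα' hσ
  have hsqrt : ∀ v ∉ (↑(S ∪ S₀) : Set (HeightOneSpectrum (𝓞 K))), ∀ a ∈ α v,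
      ‖a‖ ≤ Real.sqrt v.residueCard :=
    fun v hv a ha => norm_le_sqrt_of_summable_normSq_trace hsum hv ha
  have hcard : ∀ v ∉ (↑(S ∪ S₀) : Set (HeightOneSpectrum (𝓞 K))), Multiset.card (α v) ≤ n :=
    fun v hv => (hα'.card_eq hv).le
  have hdiff : DifferentiableOn ℂ (partialStandardL ((↑S : Set _) ∪ ↑T) α) {s : ℂ | 1 < s.re} := by
    rw [hST]
    exact (differentiableOn_partialStandardL_of_summable_normSq_trace hcard hsum).1
  -- the finitely many factors at `v ∈ T` are holomorphic on `re s > 1`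
  have hfin : DifferentiableOn ℂ (fun s : ℂ => ∏ v ∈ T,
      ((eulerPolynomial (α v)).eval ((v.residueCard : ℂ) ^ (-s)))⁻¹) {s : ℂ | 1 < s.re} := by
    refine DifferentiableOn.fun_finsetProd fun v hv => ?_
    exact differentiableOn_inv_eval_eulerPolynomial_of_norm_le v.one_lt_residueCard
      (hq P hα v (hTS v hv))
  -- assemble
  refine (hfin.mul hdiff).congr fun s hs => ?_
  have hs' : 1 < s.re := hs
  have hmul : Multipliable fun v : {v : HeightOneSpectrum (𝓞 K) // v ∉ (↑S : Set _) ∪ ↑T} =>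
      ((eulerPolynomial (α v.1)).eval ((v.1.residueCard : ℂ) ^ (-s)))⁻¹ := by
    rw [hST]
    exact multipliable_inv_eulerFactor hsqrt hcard hs' (hsum s.re hs')
  exact partialStandardL_eq_prod_mul_partialStandardL hTS α hmul

/-- **The named fact from its two numbered inputs: Lemma (5.2) and (5.1.3).** The holomorphy of
`L^S(s, Π)` on `re s > 1` (`JacquetShalika1981_differentiableOn_partialStandardL`, Jacquet–Shalika
(1981), Thm. (5.3) with Remark (5.4)) follows from the continuation of `L_S(s, π × π̄)` to
`re s > 1` (Lemma (5.2), `JacquetShalika1981_continuation_partialPairL_conj`) and the local bound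
`|μ_{j,v}| ≤ q_v^{1/2}` (Cor. (2.5) / (5.1.3), `norm_satakeParameter_le_sqrt`): the printed proof,
through (5.3.3)–(5.3.4) for arbitrary exceptional sets
(`summable_normSq_trace_satakePow_of_lemma52`, which also uses the finiteness of ramification,
proved in the tree: `eventually_cofinite_isUnramifiedAt_holds`, Flath (1979), Thm. 3) and
`JacquetShalika1981_differentiableOn_partialStandardL_of_summable`. This is the current frontier
of `JacquetShalika1981_differentiableOn_partialStandardL_holds`; by
`JacquetShalika1981_differentiableOn_partialStandardL_of_lemma52_of_norm_le` the second input may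
be weakened to `‖a‖ ≤ q_v`. [cite: JacquetShalikaAJM1981, Thm. (5.3), Lemma (5.2), (5.1.3)] -/
theorem JacquetShalika1981_differentiableOn_partialStandardL_of_lemma52
    (h₁ : norm_satakeParameter_le_sqrt (μ := μ))
    (h₅₂ : JacquetShalika1981_continuation_partialPairL_conj (μ := μ)) :
    JacquetShalika1981_differentiableOn_partialStandardL (μ := μ) :=
  JacquetShalika1981_differentiableOn_partialStandardL_of_summable
    (summable_normSq_trace_satakePow_of_lemma52 h₁ h₅₂ eventually_cofinite_isUnramifiedAt_holds)

/-- **The named fact from (5.1.3) and the Rankin–Selberg quotient representation of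
`L_S(s, π × π̄)`** (the hypothesis of
`JacquetShalika1981_continuation_partialPairL_conj_of_local_quotients` of
`RankinSelbergContinuationGlue`: for finite `S ⊇ S₀` and every `s₀`, `re s₀ > 1`, functions `I`,
`A` holomorphic on `re s > 1` with `A(s₀) ≠ 0` and `I = A · L_S(s, α × ᾱ)` far to the right — in
the source the global Rankin–Selberg integral against the mirabolic Eisenstein series, the product
of the local integrals at `S`, and the Euler factorisation of §4 with the unramified computation
of §2). [cite: JacquetShalikaAJM1981, Thm. (5.3), Lemma (5.2), p. 554–555] -/
theorem JacquetShalika1981_differentiableOn_partialStandardL_of_local_quotients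
    (h₁ : norm_satakeParameter_le_sqrt (μ := μ))
    (h : ∀ P : CuspidalAutomorphicRepGL n K μ, ∃ S₀ : Finset (HeightOneSpectrum (𝓞 K)),
      ∀ ⦃S : Finset (HeightOneSpectrum (𝓞 K))⦄ ⦃α : SatakeFamily K⦄, S₀ ⊆ S →
        IsSatakeFamilyOf P ↑S α → ∃ x₀ : ℝ, ∀ s₀ : ℂ, 1 < s₀.re →
          ∃ I A : ℂ → ℂ, DifferentiableOn ℂ I {s : ℂ | 1 < s.re} ∧
            DifferentiableOn ℂ A {s : ℂ | 1 < s.re} ∧ A s₀ ≠ 0 ∧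
              ∀ s : ℂ, 1 < s.re → x₀ < s.re →
                I s = A s * partialPairL ↑S α (conjFamily α) s) :
    JacquetShalika1981_differentiableOn_partialStandardL (μ := μ) :=
  JacquetShalika1981_differentiableOn_partialStandardL_of_lemma52 h₁
    (JacquetShalika1981_continuation_partialPairL_conj_of_local_quotients h)

/-- **The named fact from (5.3.3)–(5.3.4) in the printed generality** (finite exceptional sets
`S` containing the ramified places; Jacquet–Shalika (1981), proof of Thm. (5.3), p. 556): if for
every cuspidal `Π`, every finite `S` and every Satake family `α` of `Π` off `S` the series
`∑_{v ∉ S} ∑_{k ≥ 1} |tr A_v^k|² / (k q_v^{kσ})` converges for `σ > 1`, then `L^S(s, Π)` is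
holomorphic on `re s > 1` — directly by `differentiableOn_partialStandardL_of_summable_normSq_trace`,
for the family at hand (no finiteness of ramification needed; compare
`summable_normSq_trace_satakePow_of_finset` of `SummableNormSqTraceSatakePow`).
[cite: JacquetShalikaAJM1981, Thm. (5.3), proof, (5.3.3)–(5.3.4)] -/
theorem JacquetShalika1981_differentiableOn_partialStandardL_of_finset_summable
    (h : ∀ (P : CuspidalAutomorphicRepGL n K μ) (S : Finset (HeightOneSpectrum (𝓞 K)))
      (α : SatakeFamily K), IsSatakeFamilyOf P ↑S α → ∀ σ : ℝ, 1 < σ →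
        Summable fun kv : ℕ × {v : HeightOneSpectrum (𝓞 K) // v ∉ (↑S : Set _)} =>
          ‖((α kv.2.1).map (· ^ (kv.1 + 1))).sum‖ ^ 2 /
            ((kv.1 + 1 : ℝ) * (kv.2.1.residueCard : ℝ) ^ ((kv.1 + 1 : ℝ) * σ))) :
    JacquetShalika1981_differentiableOn_partialStandardL (μ := μ) :=
  fun P S α hα => (differentiableOn_partialStandardL_of_summable_normSq_trace
    (fun _ hv => (hα.card_eq hv).le) (h P S α hα)).1

/-! ### The named fact under the unit bound, under Ramanujan, and in rank `≤ 1` -/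

/-- **The named fact under the unit bound `‖a‖ ≤ 1`** on the Hecke–Satake parameters of the
cuspidal representations of `GL_n(𝔸_K)` off their exceptional sets: then (5.3.3)–(5.3.4) hold
(`summable_normSq_trace_satakePow_of_norm_le_one` of `SatakeParameterUnitBound`, comparison with
`n² ∑_v ∑_k q_v^{-kσ}`), hence the holomorphy of `L^S(s, Π)` on `re s > 1`. [folklore] -/
theorem JacquetShalika1981_differentiableOn_partialStandardL_of_norm_le_one
    (h : ∀ (P : CuspidalAutomorphicRepGL n K μ) ⦃S : Set (HeightOneSpectrum (𝓞 K))⦄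
      ⦃α : SatakeFamily K⦄, IsSatakeFamilyOf P S α → ∀ v ∉ S, ∀ a ∈ α v, ‖a‖ ≤ 1) :
    JacquetShalika1981_differentiableOn_partialStandardL (μ := μ) :=
  JacquetShalika1981_differentiableOn_partialStandardL_of_summable
    (summable_normSq_trace_satakePow_of_norm_le_one h)

/-- **Ramanujan implies the named fact:** under clause (i) of `Literature.Lang.RamanujanConjectureGL n`
(`|a| = 1` for the Satake parameters of cuspidal representations of `GL_n` at levels maximal at
`v`) the partial standard Euler products are holomorphic on `re s > 1` (the trivial direction;
`summable_normSq_trace_satakePow_of_ramanujan`). [folklore] -/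
theorem JacquetShalika1981_differentiableOn_partialStandardL_of_ramanujan
    (hR : Literature.NumberTheory.Automorphic.RamanujanConjectureGL n) :
    JacquetShalika1981_differentiableOn_partialStandardL (n := n) (μ := μ) :=
  JacquetShalika1981_differentiableOn_partialStandardL_of_summable
    (summable_normSq_trace_satakePow_of_ramanujan hR)

/-- **The named fact holds unconditionally in rank `n ≤ 1`:** for every cuspidal automorphic
representation `Π` of `GL_n(𝔸_K)`, `n ≤ 1` — for `n = 1` the unitary Hecke characters `χ` of
`𝔸_K^× / K^× ℝ_{>0}`, whose Hecke–Satake parameters `χ_v(ϖ_v)` have absolute value `1` over the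
tree's `L²`/Hecke-operator definitions (`norm_le_one_of_le_one` of `SatakeParameterUnitBound`);
`n = 0` is the degenerate case of empty parameters — every partial Euler product
`L^S(s, χ) = ∏_{v ∉ S} (1 - χ_v(ϖ_v) q_v^{-s})⁻¹` off a finite `S` is holomorphic on `re s > 1`
(classical: Hecke; Tate's thesis). The statement of
`JacquetShalika1981_differentiableOn_partialStandardL`, **proved** for `n ≤ 1`. [folklore] -/
theorem JacquetShalika1981_differentiableOn_partialStandardL_of_le_one (hn : n ≤ 1) :
    JacquetShalika1981_differentiableOn_partialStandardL (n := n) (μ := μ) :=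
  JacquetShalika1981_differentiableOn_partialStandardL_of_summable
    (summable_normSq_trace_satakePow_of_le_one hn)

end Cuspidal

end Literature.NumberTheory.Automorphic
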